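import Mathlib

/-!
# `FeketeSOS.FeketeSOSHard` (stmt-ValiantsHypothesis-3996) — the two-sided depth-spectrum gap is false for every constant `C ≤ 2`

Crux-triage round 2, triager 3 (escalation; `Cruxes/FeketeSOSHard/TRIAGE-r2-3.md`).  The round-2 card `depth-spectrum-gap`
(`Cruxes/FeketeSOSHard/Sketch_ideator5.lean`) transfers the crux to `DepthSpectrumGapWith C`: if `∑_{j<r} A_j B_j` over a field of
characteristic `p` (all degrees `< p`, not divisible by `X^p - 1`) has EXACT `(X-1)`-order `M`, then `M ≤ C·T` or
`p ≤ M + 1 + C·T`, `T = ∑_j (#supp A_j + #supp B_j)`.  `C ≤ 1` is refuted in `DepthSpectrumGapOne.lean`; the panel (TRIAGE-r2-2)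
recorded `C = 2` as "the live bold form" ("no M in (2T, p−1−2T) anywhere", kit j016435; every symmetric family has `M/T → 2⁻`).

THIS FILE refutes `DepthSpectrumGapWith C` for every `C ≤ 2`.  Witness (found by the targeted scan `exp/halfper_const.py` of this
triage, verified independently by honest multiplication + synthetic division, `exp/verify_dsg2.py`): `p = 353 = 44·8 + 1`, `H ≤ 𝔽₃₅₃^×`
the subgroup of order `d = 8` (`H = ⟨3⁴⁴⟩`), Gauss periods `η₀ = ∑_{h ∈ H} X^h` (exponents `[1, 42, 70, 116, 237, 283, 311, 352]`) and its HALF-PERIOD partner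
`η₂₂ = ∑_{h ∈ 3²²H} X^h` (exponents `[36, 49, 60, 100, 253, 293, 304, 317]`), and
`E = (287 + η₀)(287 + η₂₂) + 166`  (`r = 2`: `A = ![287 + η₀, C 166]`, `B = ![287 + η₂₂, 1]`, support-sum `T = 9 + 9 + 1 + 1 = 20`).
`E` is invariant under the subgroup of order `2d = 16` (which swaps the two factors), so only the `z^{16ℓ}`-coordinates of
`𝔽₃₅₃[X]/(X³⁵³−1) ≅ 𝔽₃₅₃[z]/(z³⁵³)` can be non-zero; the two free constants kill `ℓ = 0, 1` (depth `32` generically, `= 2T − 8`), and here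
ONE accidental extra vanishing (`ℓ = 2`) occurs: exact order `M = 48 = 6d`.  Since `48 > 2·20` and `48 + 1 + 2·20 = 89 < 353`, both
disjuncts of `DepthSpectrumGapWith 2` fail (`M/T = 2.4`).  The same mechanism gives `p = 229`, `d = 19`, `e = 12`:
`(37 + η₀)(37 + η₆) + 70`, `T = 42`, exact order `114 = (229−1)/2` — depth EXACTLY `N` at `M/T = 2.71` (recorded in the triage report,
not certified here).  Heuristically each further accidental vanishing (probability `≈ 1/p`, `≈ σ(p−1)/2` trials per prime) adds `2d`
to `M`, so `DepthSpectrumGapWith 3` should also fail at some larger prime, while `∃ C` survives only by sporadic luck: the typed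
conjecture has no `p ≥ p₀` clause.

Proof architecture (no big `ring` normalisation — the certificate is the DERIVATIVE criterion): `E` is expanded once into its 81
monomials (`ring`, no coefficient collisions, no reduction mod 353 needed); for a list of monomials
`(derivative^[m] E).eval 1 = ∑ c_k · k(k−1)⋯(k−m+1)` (`dsg2_eval_list`); the 48 vanishing sums (`m ≤ 47`) and the non-vanishing at
`m = 48` are checked by `decide` in `ZMod 353`; Mathlib's `lt_rootMultiplicity_of_isRoot_iterate_derivative_of_mem_nonZeroDivisors`
(`47!` is a unit mod `353`) turns them into `(X−1)^48 ∣ E`, `(X−1)^49 ∤ E`, and `X³⁵³ − 1 = (X−1)³⁵³ ∤ E` follows.  The refuted statement is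
the card's `DepthSpectrumGapWith` VERBATIM (inlined, `pairSupport` unfolded).  Mathlib only; theorems only; no definitions, no facts.
[folklore: Gauss periods; derivative criterion for multiplicity]
-/

namespace Summit.ValiantsHypothesis.ValiantsHypothesis.Theorems.FeketeSOSHard.Negative

open Polynomial Finset

-- `Summit.ValiantsHypothesis.ValiantsHypothesis.…` is the tree's mandated single-conjunct layout (Sub = Summit).
set_option linter.dupNamespace false
set_option maxRecDepth 50000
set_option maxHeartbeats 4000000

noncomputable section

/-- The 81 monomials `(exponent, coefficient)` of `E = (287 + η₀)(287 + η₂₂) + 166` expanded over `ℤ` (`82535 = 287² + 166`;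
no two products collide), read in `ZMod 353`. -/
local notation "dsg2L" => ([(0, 82535), (1, 287), (36, 287), (37, 1), (42, 287), (49, 287), (50, 1), (60, 287), (61, 1), (70, 287), (78, 1), (91, 1), (100, 287), (101, 1), (102, 1), (106, 1), (116, 287), (119, 1), (130, 1), (142, 1), (152, 1), (165, 1), (170, 1), (176, 1), (216, 1), (237, 287), (253, 287), (254, 1), (273, 1), (283, 287), (286, 1), (293, 287), (294, 1), (295, 1), (297, 1), (304, 287), (305, 1), (311, 287), (317, 287), (318, 1), (319, 1), (323, 1), (332, 1), (335, 1), (337, 1), (343, 1), (346, 1), (347, 1), (352, 287), (359, 1), (360, 1), (363, 1), (369, 1), (371, 1), (374, 1), (383, 1), (387, 1), (388, 1), (401, 1), (409, 1), (411, 1), (412, 1), (420, 1), (433, 1), (452, 1), (490, 1), (530, 1), (536, 1), (541, 1), (554, 1), (564, 1), (576, 1), (587, 1), (600, 1), (604, 1), (605, 1), (615, 1), (628, 1), (645, 1), (656, 1), (669, 1)] : List (ℕ × ZMod 353))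

/-! ## Generic plumbing: iterated derivatives of a list of monomials, evaluated at `1` -/

/-- Iterated derivatives are additive (`derivative` is linear). -/
theorem dsg2_iterate_derivative_add {R : Type*} [CommRing R] (k : ℕ) (f g : R[X]) :
    derivative^[k] (f + g) = derivative^[k] f + derivative^[k] g := by
  simp_rw [← Module.End.pow_apply, map_add]

/-- `(d/dX)^m` of a list of monomials `C c * X^k`, evaluated at `1`, is `∑ c · k(k-1)⋯(k-m+1)`. -/
theorem dsg2_eval_list {R : Type*} [CommRing R] (m : ℕ) (L : List (ℕ × R)) :
    (derivative^[m] ((L.map fun x => C x.2 * X ^ x.1).sum)).eval 1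
      = (L.map fun x => x.2 * ((x.1.descFactorial m : ℕ) : R)).sum := by
  induction L with
  | nil => simp
  | cons x L ih =>
      rw [List.map_cons, List.sum_cons, List.map_cons, List.sum_cons, dsg2_iterate_derivative_add,
        eval_add, ih, iterate_derivative_C_mul, iterate_derivative_X_pow_eq_C_mul, eval_mul, eval_C,
        eval_mul, eval_C, eval_pow, eval_X, one_pow, mul_one]

/-! ## The numerical certificate (kernel `decide` in `ZMod 353`) -/

/-- The first `48` "falling moments" of `E` vanish mod `353` … -/
theorem dsg2_moments_vanish :
    ∀ m ≤ 47, ((dsg2L).map fun x => x.2 * ((x.1.descFactorial m : ℕ) : ZMod 353)).sum = 0 := by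
  decide +kernel

/-- … and the `49`-th does not. -/
theorem dsg2_moment48 :
    ((dsg2L).map fun x => x.2 * ((x.1.descFactorial 48 : ℕ) : ZMod 353)).sum ≠ 0 := by
  decide +kernel

/-- `47!` is a unit modulo the prime `353`. -/
theorem dsg2_factorial47 : ((Nat.factorial 47 : ℕ) : ZMod 353) ≠ 0 := by
  decide +kernel

/-! ## The configuration over `𝔽₃₅₃` -/

/-- Expansion of the two period binomials' product plus the constant into the 81 monomials (no collisions, no reduction). -/
theorem dsg2_expand :
    (C 287 * X ^ 0 + C 1 * X ^ 1 + C 1 * X ^ 42 + C 1 * X ^ 70 + C 1 * X ^ 116 + C 1 * X ^ 237 + C 1 * X ^ 283 + C 1 * X ^ 311 + C 1 * X ^ 352 : (ZMod 353)[X])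
        * (C 287 * X ^ 0 + C 1 * X ^ 36 + C 1 * X ^ 49 + C 1 * X ^ 60 + C 1 * X ^ 100 + C 1 * X ^ 253 + C 1 * X ^ 293 + C 1 * X ^ 304 + C 1 * X ^ 317) + C 166 * 1
      = ((dsg2L).map fun x => C x.2 * X ^ x.1).sum := by
  simp only [List.map_cons, List.map_nil, List.sum_cons, List.sum_nil, map_one, map_ofNat, pow_zero, mul_one, one_mul,
    add_zero]
  ring

/-- Support of a sum is at most the sum of the supports. -/
theorem dsg2_card_support_add_le {R : Type*} [Semiring R] (f g : R[X]) :
    (f + g).support.card ≤ f.support.card + g.support.card :=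
  (card_le_card support_add).trans (card_union_le _ _)

/-- A nine-term sum of monomials has at most nine exponents in its support. -/
theorem dsg2_card_support_nine {R : Type*} [Semiring R] (a₀ a₁ a₂ a₃ a₄ a₅ a₆ a₇ a₈ : R) (k₀ k₁ k₂ k₃ k₄ k₅ k₆ k₇ k₈ : ℕ) :
    (C a₀ * X ^ k₀ + C a₁ * X ^ k₁ + C a₂ * X ^ k₂ + C a₃ * X ^ k₃ + C a₄ * X ^ k₄ + C a₅ * X ^ k₅ + C a₆ * X ^ k₆
        + C a₇ * X ^ k₇ + C a₈ * X ^ k₈).support.card ≤ 9 := by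
  have h8 := dsg2_card_support_add_le (C a₀ * X ^ k₀ + C a₁ * X ^ k₁ + C a₂ * X ^ k₂ + C a₃ * X ^ k₃ + C a₄ * X ^ k₄
    + C a₅ * X ^ k₅ + C a₆ * X ^ k₆ + C a₇ * X ^ k₇) (C a₈ * X ^ k₈)
  have h7 := dsg2_card_support_add_le (C a₀ * X ^ k₀ + C a₁ * X ^ k₁ + C a₂ * X ^ k₂ + C a₃ * X ^ k₃ + C a₄ * X ^ k₄
    + C a₅ * X ^ k₅ + C a₆ * X ^ k₆) (C a₇ * X ^ k₇)
  have h6 := dsg2_card_support_add_le (C a₀ * X ^ k₀ + C a₁ * X ^ k₁ + C a₂ * X ^ k₂ + C a₃ * X ^ k₃ + C a₄ * X ^ k₄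
    + C a₅ * X ^ k₅) (C a₆ * X ^ k₆)
  have h5 := dsg2_card_support_add_le (C a₀ * X ^ k₀ + C a₁ * X ^ k₁ + C a₂ * X ^ k₂ + C a₃ * X ^ k₃ + C a₄ * X ^ k₄)
    (C a₅ * X ^ k₅)
  have h4 := dsg2_card_support_add_le (C a₀ * X ^ k₀ + C a₁ * X ^ k₁ + C a₂ * X ^ k₂ + C a₃ * X ^ k₃) (C a₄ * X ^ k₄)
  have h3 := dsg2_card_support_add_le (C a₀ * X ^ k₀ + C a₁ * X ^ k₁ + C a₂ * X ^ k₂) (C a₃ * X ^ k₃)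
  have h2 := dsg2_card_support_add_le (C a₀ * X ^ k₀ + C a₁ * X ^ k₁) (C a₂ * X ^ k₂)
  have h1 := dsg2_card_support_add_le (C a₀ * X ^ k₀) (C a₁ * X ^ k₁)
  have e₀ : (C a₀ * X ^ k₀).support.card ≤ 1 := card_support_C_mul_X_pow_le_one
  have e₁ : (C a₁ * X ^ k₁).support.card ≤ 1 := card_support_C_mul_X_pow_le_one
  have e₂ : (C a₂ * X ^ k₂).support.card ≤ 1 := card_support_C_mul_X_pow_le_one
  have e₃ : (C a₃ * X ^ k₃).support.card ≤ 1 := card_support_C_mul_X_pow_le_one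
  have e₄ : (C a₄ * X ^ k₄).support.card ≤ 1 := card_support_C_mul_X_pow_le_one
  have e₅ : (C a₅ * X ^ k₅).support.card ≤ 1 := card_support_C_mul_X_pow_le_one
  have e₆ : (C a₆ * X ^ k₆).support.card ≤ 1 := card_support_C_mul_X_pow_le_one
  have e₇ : (C a₇ * X ^ k₇).support.card ≤ 1 := card_support_C_mul_X_pow_le_one
  have e₈ : (C a₈ * X ^ k₈).support.card ≤ 1 := card_support_C_mul_X_pow_le_one
  omega

/-- **The `p = 353` configuration**: `(287 + η₀)(287 + η₂₂) + 166·1` — two products, all degrees `< 353`, support-sum `≤ 20`,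
not divisible by `X³⁵³ − 1`, of EXACT `(X−1)`-order `48`. -/
theorem dsg2_witness353 :
    ∃ (A B : Fin 2 → (ZMod 353)[X]),
      (∀ j, (A j).natDegree < 353 ∧ (B j).natDegree < 353) ∧
      ¬ ((X : (ZMod 353)[X]) ^ 353 - 1 ∣ ∑ j, A j * B j) ∧
      (X - 1 : (ZMod 353)[X]) ^ 48 ∣ ∑ j, A j * B j ∧
      ¬ ((X - 1 : (ZMod 353)[X]) ^ (48 + 1) ∣ ∑ j, A j * B j) ∧
      (∑ j, ((A j).support.card + (B j).support.card)) ≤ 20 := by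
  haveI hp : Fact (Nat.Prime 353) := ⟨by norm_num⟩
  refine ⟨![C 287 * X ^ 0 + C 1 * X ^ 1 + C 1 * X ^ 42 + C 1 * X ^ 70 + C 1 * X ^ 116 + C 1 * X ^ 237 + C 1 * X ^ 283 + C 1 * X ^ 311 + C 1 * X ^ 352, C 166], ![C 287 * X ^ 0 + C 1 * X ^ 36 + C 1 * X ^ 49 + C 1 * X ^ 60 + C 1 * X ^ 100 + C 1 * X ^ 253 + C 1 * X ^ 293 + C 1 * X ^ 304 + C 1 * X ^ 317, 1], ?_, ?_⟩
  · -- degrees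
    intro j
    fin_cases j
    · show (C 287 * X ^ 0 + C 1 * X ^ 1 + C 1 * X ^ 42 + C 1 * X ^ 70 + C 1 * X ^ 116 + C 1 * X ^ 237 + C 1 * X ^ 283 + C 1 * X ^ 311 + C 1 * X ^ 352 : (ZMod 353)[X]).natDegree < 353 ∧
        (C 287 * X ^ 0 + C 1 * X ^ 36 + C 1 * X ^ 49 + C 1 * X ^ 60 + C 1 * X ^ 100 + C 1 * X ^ 253 + C 1 * X ^ 293 + C 1 * X ^ 304 + C 1 * X ^ 317 : (ZMod 353)[X]).natDegree < 353
      constructor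
      · have : (C 287 * X ^ 0 + C 1 * X ^ 1 + C 1 * X ^ 42 + C 1 * X ^ 70 + C 1 * X ^ 116 + C 1 * X ^ 237 + C 1 * X ^ 283 + C 1 * X ^ 311 + C 1 * X ^ 352 : (ZMod 353)[X]).natDegree ≤ 352 := by
          compute_degree
        omega
      · have : (C 287 * X ^ 0 + C 1 * X ^ 36 + C 1 * X ^ 49 + C 1 * X ^ 60 + C 1 * X ^ 100 + C 1 * X ^ 253 + C 1 * X ^ 293 + C 1 * X ^ 304 + C 1 * X ^ 317 : (ZMod 353)[X]).natDegree ≤ 317 := by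
          compute_degree
        omega
    · show (C 166 : (ZMod 353)[X]).natDegree < 353 ∧ (1 : (ZMod 353)[X]).natDegree < 353
      rw [natDegree_C, natDegree_one]
      omega
  -- the sum, expanded into the list of 81 monomials
  have hsum : (∑ j, (![C 287 * X ^ 0 + C 1 * X ^ 1 + C 1 * X ^ 42 + C 1 * X ^ 70 + C 1 * X ^ 116 + C 1 * X ^ 237 + C 1 * X ^ 283 + C 1 * X ^ 311 + C 1 * X ^ 352, C 166] : Fin 2 → (ZMod 353)[X]) j *
      (![C 287 * X ^ 0 + C 1 * X ^ 36 + C 1 * X ^ 49 + C 1 * X ^ 60 + C 1 * X ^ 100 + C 1 * X ^ 253 + C 1 * X ^ 293 + C 1 * X ^ 304 + C 1 * X ^ 317, 1] : Fin 2 → (ZMod 353)[X]) j)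
      = ((dsg2L).map fun x => C x.2 * X ^ x.1).sum := by
    rw [Fin.sum_univ_two, ← dsg2_expand]; rfl
  set E : (ZMod 353)[X] := ((dsg2L).map fun x => C x.2 * X ^ x.1).sum with hE
  -- falling moments
  have hroot : ∀ m ≤ 47, (derivative^[m] E).IsRoot 1 := by
    intro m hm
    rw [IsRoot.def, hE, dsg2_eval_list]
    exact dsg2_moments_vanish m hm
  have h48 : ¬ (derivative^[48] E).IsRoot 1 := by
    rw [IsRoot.def, hE, dsg2_eval_list]
    exact dsg2_moment48
  have hE0 : E ≠ 0 := by
    intro h0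
    apply h48
    rw [h0, iterate_derivative_zero]
    exact IsRoot.def.mpr (eval_zero)
  -- multiplicity ≥ 48
  have hmult : 47 < E.rootMultiplicity 1 :=
    lt_rootMultiplicity_of_isRoot_iterate_derivative_of_mem_nonZeroDivisors hE0 hroot
      (mem_nonZeroDivisors_of_ne_zero dsg2_factorial47)
  have hC1 : (X - 1 : (ZMod 353)[X]) = X - C 1 := by rw [C_1]
  have hdvd : (X - 1 : (ZMod 353)[X]) ^ 48 ∣ E := by
    rw [hC1]
    exact (pow_dvd_pow (X - C 1) hmult).trans (pow_rootMultiplicity_dvd E 1)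
  have hndvd : ¬ ((X - 1 : (ZMod 353)[X]) ^ (48 + 1) ∣ E) := by
    intro h
    rw [hC1] at h
    have h49 : 48 + 1 ≤ E.rootMultiplicity 1 := (le_rootMultiplicity_iff hE0).mpr h
    exact h48 (isRoot_iterate_derivative_of_lt_rootMultiplicity (by omega))
  refine ⟨?_, ?_, ?_, ?_⟩
  · -- not divisible by X^353 - 1 = (X - 1)^353
    intro h
    rw [hsum, show (X : (ZMod 353)[X]) ^ 353 - 1 = (X - 1) ^ 353 by rw [sub_pow_char, one_pow]] at h
    exact hndvd ((pow_dvd_pow (X - 1 : (ZMod 353)[X]) (by norm_num : 48 + 1 ≤ 353)).trans h)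
  · rw [hsum]; exact hdvd
  · rw [hsum]; exact hndvd
  · -- support-sum ≤ 9 + 9 + 1 + 1
    rw [Fin.sum_univ_two]
    show (C 287 * X ^ 0 + C 1 * X ^ 1 + C 1 * X ^ 42 + C 1 * X ^ 70 + C 1 * X ^ 116 + C 1 * X ^ 237 + C 1 * X ^ 283 + C 1 * X ^ 311 + C 1 * X ^ 352 : (ZMod 353)[X]).support.card
          + (C 287 * X ^ 0 + C 1 * X ^ 36 + C 1 * X ^ 49 + C 1 * X ^ 60 + C 1 * X ^ 100 + C 1 * X ^ 253 + C 1 * X ^ 293 + C 1 * X ^ 304 + C 1 * X ^ 317 : (ZMod 353)[X]).support.card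
        + ((C 166 : (ZMod 353)[X]).support.card + (1 : (ZMod 353)[X]).support.card) ≤ 20
    have hA : (C 287 * X ^ 0 + C 1 * X ^ 1 + C 1 * X ^ 42 + C 1 * X ^ 70 + C 1 * X ^ 116 + C 1 * X ^ 237 + C 1 * X ^ 283 + C 1 * X ^ 311 + C 1 * X ^ 352 : (ZMod 353)[X]).support.card ≤ 9 := dsg2_card_support_nine _ _ _ _ _ _ _ _ _ _ _ _ _ _ _ _ _ _
    have hB : (C 287 * X ^ 0 + C 1 * X ^ 36 + C 1 * X ^ 49 + C 1 * X ^ 60 + C 1 * X ^ 100 + C 1 * X ^ 253 + C 1 * X ^ 293 + C 1 * X ^ 304 + C 1 * X ^ 317 : (ZMod 353)[X]).support.card ≤ 9 := dsg2_card_support_nine _ _ _ _ _ _ _ _ _ _ _ _ _ _ _ _ _ _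
    have hc : (C 166 : (ZMod 353)[X]).support.card ≤ 1 := by
      rw [← mul_one (C (166 : ZMod 353)), ← pow_zero X]; exact card_support_C_mul_X_pow_le_one
    have h1 : (1 : (ZMod 353)[X]).support.card ≤ 1 := by
      rw [← C_1, ← mul_one (C (1 : ZMod 353)), ← pow_zero X]; exact card_support_C_mul_X_pow_le_one
    omega

/-! ## The refutation -/

/-- **The two-sided depth-spectrum gap is false for every constant `C ≤ 2`, in the middle window.**
The negated statement is the card's `DepthSpectrumGap.DepthSpectrumGapWith C` verbatim (`pairSupport` unfolded): witness
`p = 353`, `(287 + η₀)(287 + η₂₂) + 166`, support-sum `20`, exact `(X−1)`-order `48`, `48 > 2·20`, `48 + 1 + 2·20 < 353`. -/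
theorem not_depthSpectrumGapWith_of_le_two (C : ℕ) (hC : C ≤ 2) :
    ¬ (∀ (K : Type) [Field K] (p : ℕ) [Fact p.Prime] [CharP K p] (r : ℕ) (A B : Fin r → K[X]) (M : ℕ),
        (∀ j, (A j).natDegree < p ∧ (B j).natDegree < p) →
        ¬ ((X : K[X]) ^ p - 1 ∣ ∑ j, A j * B j) →
        (X - 1 : K[X]) ^ M ∣ ∑ j, A j * B j →
        ¬ ((X - 1 : K[X]) ^ (M + 1) ∣ ∑ j, A j * B j) →
        M ≤ C * (∑ j, ((A j).support.card + (B j).support.card)) ∨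
          p ≤ M + 1 + C * (∑ j, ((A j).support.card + (B j).support.card))) := by
  intro h
  haveI hp : Fact (Nat.Prime 353) := ⟨by norm_num⟩
  obtain ⟨A, B, hdeg, hnd, hdvd, hndvd, hT⟩ := dsg2_witness353
  have hmain := h (ZMod 353) 353 2 A B 48 hdeg hnd hdvd hndvd
  have hCT : C * (∑ j, ((A j).support.card + (B j).support.card)) ≤ 40 :=
    (Nat.mul_le_mul hC hT).trans (by norm_num)
  omega

/-- The panel's "live bold form" `C = 2` (TRIAGE-r2-2: "no M in (2T, p−1−2T) anywhere"): false at `p = 353`. -/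
theorem not_depthSpectrumGapWith_two :
    ¬ (∀ (K : Type) [Field K] (p : ℕ) [Fact p.Prime] [CharP K p] (r : ℕ) (A B : Fin r → K[X]) (M : ℕ),
        (∀ j, (A j).natDegree < p ∧ (B j).natDegree < p) →
        ¬ ((X : K[X]) ^ p - 1 ∣ ∑ j, A j * B j) →
        (X - 1 : K[X]) ^ M ∣ ∑ j, A j * B j →
        ¬ ((X - 1 : K[X]) ^ (M + 1) ∣ ∑ j, A j * B j) →
        M ≤ 2 * (∑ j, ((A j).support.card + (B j).support.card)) ∨
          p ≤ M + 1 + 2 * (∑ j, ((A j).support.card + (B j).support.card))) :=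
  not_depthSpectrumGapWith_of_le_two 2 le_rfl

end

end Summit.ValiantsHypothesis.ValiantsHypothesis.Theorems.FeketeSOSHard.Negative
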